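import Summits.BirchSwinnertonDyer.BirchSwinnertonDyer.Theorems.ThetaPartnerAtTwoSignedControlAtTwoMuRealMiddleExact
import Summits.BirchSwinnertonDyer.BirchSwinnertonDyer.Theorems.KolyvaginRoadThreePTDevissageTrivialHE
import HarnessLib

/-!
# Milne *ADT* I Thm. 4.10(b) `Ker γ¹ ⊆ Im β¹` for `μₙ^D = Hom(μₙ, μₙ)` and for the CONSTANT module `ℤ/n`,
# every level, every number field, REAL places included

Route `ThetaPartnerAtTwo`, crux K4 `SignedControlAtTwo` (stmt-BirchSwinnertonDyer-20309), line `eulerchar` v10, lead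
`bsd-wall-tp2-p3` g4 (`--supports stmt-BirchSwinnertonDyer-20309`, helper).  File 3/3 of the μₙ-with-real-places
packet (`…MuRealKummer`, `…MuRealMiddleExact`): the two corollaries that the Poitou–Tate toolkit
(`SchneiderFreeAdditiveX3PoitouTateMuLevelMiddleExact` §2–§3) derives from the μₙ-case by biduality transport and
duality symmetry — now WITHOUT the archimedean hypothesis `∀ w, w.IsReal → Odd n`, because the transport tools
(`middleExact_of_equiv`, `middleExact_canonical_of_middleExact_tateDual`) never used it:

* `middleExact_canonical_muBidual_level_real` — `M = μₙ^{DD}`;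
* `middleExact_canonical_muDual_level_real` — `M = μₙ^D = Hom(μₙ, μₙ)`;
* `middleExact_canonical_trivial_level_real` — `M = ℤ/n` with ANY trivial-action structure: Grunwald–Wang with
  ramification control in Poitou–Tate form, over every number field, at every level (`n` even allowed, real places
  allowed) — e.g. `K = ℚ`, `n = 2^k`, the base case of every 2-primary dévissage toward
  `poitouTate_selmerStructure_duality ℚ` (the PT conjunct of K4's registered stub `stub_pubGreenbergPTTwo`);
* `middleExact_canonical_of_trivial_of_card_eq_real` — the same for a trivial module of PRIME order `p` on ANY
  carrier (bsd-stepL koly's `middleExact_canonical_of_trivial_of_card_eq` without `harch`): the input shape of the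
  koly dévissage `middleExact_of_extension` / `middleExact_canonical_of_unipotentTwo_all` at `p = 2`.

HONEST FRAMING. THEOREMS ONLY (no definition, no named fact, no instance, no sorry); these are the rank-one constant /
cyclotomic coefficient modules only — the general `∀ M` statement is NOT claimed; no item closes; BSD is not proved by
any of this.

References: [MilneADT2006] I Thm. 4.10(b), Prop. 0.19; [NeukirchSchmidtWingberg2008] VIII §6, IX §1 (Grunwald–Wang);
[CasselsFrohlichANT1967] VII §11.
-/

noncomputable section

open CategoryTheory Function NumberField IsDedekindDomain Field
open scoped NumberField ContRepresentation

set_option linter.dupNamespace false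
set_option autoImplicit false

namespace Summit.BirchSwinnertonDyer.BirchSwinnertonDyer.Theorems.SignedEC.MuReal

open _root_.ContinuousCohomology
open Literature.NumberTheory.GaloisRepresentations
open Literature.NumberTheory.GaloisRepresentations.DiscreteGaloisModule
open Literature.NumberTheory.GaloisCohomology
open _root_.TopRep _root_.ContRepresentation
open Summit.BirchSwinnertonDyer.BirchSwinnertonDyer.Theorems.SchneiderFreeAdditiveX3.PoitouTateReduction

variable {K : Type} [Field K] [NumberField K] {n : ℕ} [NeZero n]

/-- **Milne *ADT* I Thm. 4.10(b) `Ker γ¹ ⊆ Im β¹` for `M = μₙ^{DD}`, every level `n`, every number field, real places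
included**: `middleExact_mu_level_real` transported along biduality `μₙ ⥲ μₙ^{DD}` (`exists_bidual_intertwining`,
`middleExact_of_equiv`). [cite: MilneADT2006, Ch. I, Thm. 4.10(b) and Prop. 0.19] -/
theorem middleExact_canonical_muBidual_level_real [Finite (TateDual K (MuCarrier K n) n)]
    [Finite (TateDual K (TateDual K (MuCarrier K n) n) n)]
    (S : Finset (Place K)) (hinf : ∀ w : InfinitePlace K, (Sum.inl w : Place K) ∈ S)
    (hS : ∀ v : HeightOneSpectrum (𝓞 K), (Sum.inr v : Place K) ∉ S →
      ((n : ℕ) : 𝓞 K) ∉ v.asIdeal ∧ GaloisRep.IsUnramifiedAt v (mu K n))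
    (t : Π v : Place K, galoisCohomology ((((mu K n).tateDual n).tateDual n).toLocal v) 1)
    (horth : ∀ y : galoisCohomology ((((mu K n).tateDual n).tateDual n).tateDual n) 1,
      (∀ v : HeightOneSpectrum (𝓞 K), (Sum.inr v : Place K) ∉ S →
        galoisCohomology.localization ((((mu K n).tateDual n).tateDual n).tateDual n) (Sum.inr v) 1 y ∈
          unramifiedSubgroup (GaloisRep.toLocal v ((((mu K n).tateDual n).tateDual n).tateDual n)) 1) →
      ∑ v ∈ S, localTatePairingZMod (((mu K n).tateDual n).tateDual n) n v (LocalInvariants.canonical K n v)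
        (t v) (galoisCohomology.localization ((((mu K n).tateDual n).tateDual n).tateDual n) v 1 y) = 0) :
    ∃ x : galoisCohomology (((mu K n).tateDual n).tateDual n) 1,
      (∀ v : HeightOneSpectrum (𝓞 K), (Sum.inr v : Place K) ∉ S →
        galoisCohomology.localization (((mu K n).tateDual n).tateDual n) (Sum.inr v) 1 x ∈
          unramifiedSubgroup (GaloisRep.toLocal v (((mu K n).tateDual n).tateDual n)) 1) ∧
      ∀ v ∈ S, galoisCohomology.localization (((mu K n).tateDual n).tateDual n) v 1 x = t v := by
  obtain ⟨ι, κ, -, -, hικ⟩ := exists_bidual_intertwining (n := n) (mu K n) (mu_nsmul_eq_zero_level (K := K) (n := n))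
  exact middleExact_of_equiv (LocalInvariants.canonical K n) (mu K n) (((mu K n).tateDual n).tateDual n) ι κ
    hικ (fun t' horth' => middleExact_mu_level_real S hinf hS t' horth') t horth

/-- **Milne *ADT* I Thm. 4.10(b) `Ker γ¹ ⊆ Im β¹` for `M = μₙ^D = Hom(μₙ, μₙ)` (`≅ ℤ/n`), every level `n`, every
number field, real places included**: `hE(μₙ^{DD}) = hE((μₙ^D)^D)` (`middleExact_canonical_muBidual_level_real`) and
the duality symmetry `middleExact_canonical_of_middleExact_tateDual` (which needs THE maps perfect at the finite places
and injective at the real ones — both kernel theorems). [cite: MilneADT2006, Ch. I, Thm. 4.10(b)]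
[cite: CasselsFrohlichANT1967, Ch. VII §11] -/
theorem middleExact_canonical_muDual_level_real [Finite (TateDual K (MuCarrier K n) n)]
    (S : Finset (Place K)) (hinf : ∀ w : InfinitePlace K, (Sum.inl w : Place K) ∈ S)
    (hS : ∀ v : HeightOneSpectrum (𝓞 K), (Sum.inr v : Place K) ∉ S →
      ((n : ℕ) : 𝓞 K) ∉ v.asIdeal ∧ GaloisRep.IsUnramifiedAt v (mu K n))
    (t : Π v : Place K, galoisCohomology (((mu K n).tateDual n).toLocal v) 1)
    (horth : ∀ y : galoisCohomology (((mu K n).tateDual n).tateDual n) 1,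
      (∀ v : HeightOneSpectrum (𝓞 K), (Sum.inr v : Place K) ∉ S →
        galoisCohomology.localization (((mu K n).tateDual n).tateDual n) (Sum.inr v) 1 y ∈
          unramifiedSubgroup (GaloisRep.toLocal v (((mu K n).tateDual n).tateDual n)) 1) →
      ∑ v ∈ S, localTatePairingZMod ((mu K n).tateDual n) n v (LocalInvariants.canonical K n v) (t v)
        (galoisCohomology.localization (((mu K n).tateDual n).tateDual n) v 1 y) = 0) :
    ∃ x : galoisCohomology ((mu K n).tateDual n) 1,
      (∀ v : HeightOneSpectrum (𝓞 K), (Sum.inr v : Place K) ∉ S →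
        galoisCohomology.localization ((mu K n).tateDual n) (Sum.inr v) 1 x ∈
          unramifiedSubgroup (GaloisRep.toLocal v ((mu K n).tateDual n)) 1) ∧
      ∀ v ∈ S, galoisCohomology.localization ((mu K n).tateDual n) v 1 x = t v := by
  haveI := DiscreteGaloisModule.TateDual.finite K (TateDual K (MuCarrier K n) n) n
  exact middleExact_canonical_of_middleExact_tateDual ((mu K n).tateDual n)
    (fun f => DiscreteGaloisModule.TateDual.nsmul_eq_zero f)
    (fun u hu => middleExact_canonical_muBidual_level_real S hinf hS u hu) t horth

/-- **Milne *ADT* I Thm. 4.10(b) `Ker γ¹ ⊆ Im β¹` for the CONSTANT module `M = ℤ/n`, every level `n`, every number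
field, REAL places included** (any discrete Galois module structure `ρ` on `ZMod n` with trivial action), THE invariant
maps, every finite `S ⊇ {v ∣ ∞} ∪ {v ∣ n}`: transport of `middleExact_canonical_muDual_level_real` along
`ℤ/n ⥲ Hom(μₙ, μₙ)` (`exists_trivial_intertwining_muDual_bijective_level`).  Classically this is Grunwald–Wang with
ramification control in Poitou–Tate form: local characters `χ_v : Γ_{K_v} → ℤ/n` (`v ∈ S`, the sign characters at the
real places among them) with `∑_{v∈S} inv_v(χ_v ∪ y_v) = 0` for every `y ∈ H¹(K, μₙ)` unramified outside `S` are the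
restrictions of ONE global character `Γ_K → ℤ/n` unramified outside `S`.
[cite: MilneADT2006, Ch. I, Thm. 4.10(b)] [cite: NeukirchSchmidtWingberg2008, VIII §6] -/
theorem middleExact_canonical_trivial_level_real [Finite (ZMod n)]
    (ρ : DiscreteGaloisModule K (ZMod n)) (htriv : ∀ (σ : absoluteGaloisGroup K) (m : ZMod n), ρ σ m = m)
    (S : Finset (Place K)) (hinf : ∀ w : InfinitePlace K, (Sum.inl w : Place K) ∈ S)
    (hS : ∀ v : HeightOneSpectrum (𝓞 K), (Sum.inr v : Place K) ∉ S → ((n : ℕ) : 𝓞 K) ∉ v.asIdeal)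
    (t : Π v : Place K, galoisCohomology (ρ.toLocal v) 1)
    (horth : ∀ y : galoisCohomology (ρ.tateDual n) 1,
      (∀ v : HeightOneSpectrum (𝓞 K), (Sum.inr v : Place K) ∉ S →
        galoisCohomology.localization (ρ.tateDual n) (Sum.inr v) 1 y ∈
          unramifiedSubgroup (GaloisRep.toLocal v (ρ.tateDual n)) 1) →
      ∑ v ∈ S, localTatePairingZMod ρ n v (LocalInvariants.canonical K n v) (t v)
        (galoisCohomology.localization (ρ.tateDual n) v 1 y) = 0) :
    ∃ x : galoisCohomology ρ 1,
      (∀ v : HeightOneSpectrum (𝓞 K), (Sum.inr v : Place K) ∉ S →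
        galoisCohomology.localization ρ (Sum.inr v) 1 x ∈ unramifiedSubgroup (GaloisRep.toLocal v ρ) 1) ∧
      ∀ v ∈ S, galoisCohomology.localization ρ v 1 x = t v := by
  haveI := DiscreteGaloisModule.TateDual.finite K (MuCarrier K n) n
  obtain ⟨φ, -, hφbij⟩ := exists_trivial_intertwining_muDual_bijective_level ρ htriv
  obtain ⟨ψ, hψφ, -⟩ := exists_inverse_intertwining_of_bijective φ hφbij
  -- `μₙ` is unramified at `v ∤ n`
  have hS' : ∀ v : HeightOneSpectrum (𝓞 K), (Sum.inr v : Place K) ∉ S →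
      ((n : ℕ) : 𝓞 K) ∉ v.asIdeal ∧ GaloisRep.IsUnramifiedAt v (mu K n) := fun v hv =>
    ⟨hS v hv, isUnramifiedAt_mu v (hS v hv)⟩
  exact middleExact_of_equiv (LocalInvariants.canonical K n) ((mu K n).tateDual n) ρ ψ φ hψφ
    (fun t' horth' => middleExact_canonical_muDual_level_real S hinf hS' t' horth') t horth

/-- **Milne I Thm. 4.10(b) for a TRIVIAL module of prime order `p` on any carrier, THE invariant maps, every
admissible `S`, every number field — real places included (`p = 2` allowed)**: transport of
`middleExact_canonical_trivial_level_real` along `ZMod p ≃ A` (`addEquivOfPrimeCardEq`, `exists_intertwining_of_trivial`,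
`middleExact_of_equiv`); bsd-stepL koly's `middleExact_canonical_of_trivial_of_card_eq` without its hypothesis
`∀ w, w.IsReal → Odd p`. [cite: MilneADT2006, Ch. I, Thm. 4.10(b)] -/
theorem middleExact_canonical_of_trivial_of_card_eq_real {p : ℕ} [hp : Fact p.Prime]
    {A : Type} [AddCommGroup A] [TopologicalSpace A] [DiscreteTopology A] [Finite A]
    (ρA : DiscreteGaloisModule K A) (hA : ∀ (σ : absoluteGaloisGroup K) (a : A), ρA σ a = a)
    (hcard : Nat.card A = p) (S : Finset (Place K))
    (hinf : ∀ w : InfinitePlace K, (Sum.inl w : Place K) ∈ S)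
    (hS : ∀ v : HeightOneSpectrum (𝓞 K), (Sum.inr v : Place K) ∉ S → ((p : ℕ) : 𝓞 K) ∉ v.asIdeal)
    (t : Π v : Place K, galoisCohomology (ρA.toLocal v) 1)
    (horth : ∀ y : galoisCohomology (ρA.tateDual p) 1,
      (∀ v : HeightOneSpectrum (𝓞 K), (Sum.inr v : Place K) ∉ S →
        galoisCohomology.localization (ρA.tateDual p) (Sum.inr v) 1 y ∈
          unramifiedSubgroup (GaloisRep.toLocal v (ρA.tateDual p)) 1) →
      ∑ v ∈ S, localTatePairingZMod ρA p v (LocalInvariants.canonical K p v) (t v)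
        (galoisCohomology.localization (ρA.tateDual p) v 1 y) = 0) :
    ∃ x : galoisCohomology ρA 1,
      (∀ v : HeightOneSpectrum (𝓞 K), (Sum.inr v : Place K) ∉ S →
        galoisCohomology.localization ρA (Sum.inr v) 1 x ∈ unramifiedSubgroup (GaloisRep.toLocal v ρA) 1) ∧
      ∀ v ∈ S, galoisCohomology.localization ρA v 1 x = t v := by
  haveI : NeZero p := ⟨hp.out.ne_zero⟩
  -- the trivial structure on the carrier `ZMod p` and the isomorphism `ZMod p ≃ A`
  let ρ₀ : DiscreteGaloisModule K (ZMod p) := ContinuousRep.trivial (absoluteGaloisGroup K) ℤ (ZMod p)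
  have h₀ : ∀ (σ : absoluteGaloisGroup K) (m : ZMod p), ρ₀ σ m = m := fun σ m => rfl
  let e : ZMod p ≃+ A := addEquivOfPrimeCardEq (Nat.card_zmod p) hcard
  obtain ⟨ι, hι⟩ := KolyvaginRoadThreePT.exists_intertwining_of_trivial ρ₀ ρA h₀ hA e.toAddMonoidHom
  obtain ⟨κ, hκ⟩ := KolyvaginRoadThreePT.exists_intertwining_of_trivial ρA ρ₀ hA h₀ e.symm.toAddMonoidHom
  have hικ : ∀ a : A, ι (κ a) = a := fun a => by
    rw [hι, hκ]
    exact e.apply_symm_apply a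
  exact middleExact_of_equiv (LocalInvariants.canonical K p) ρ₀ ρA ι κ hικ
    (middleExact_canonical_trivial_level_real (n := p) ρ₀ h₀ S hinf hS) t horth

end Summit.BirchSwinnertonDyer.BirchSwinnertonDyer.Theorems.SignedEC.MuReal

end
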